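import Literature.Algebra.Homology.NatCochainLongExactSequence
import HarnessLib

/-!
# The cokernel complex of an injective cochain map and its short exact sequence

C. A. Weibel, *An Introduction to Homological Algebra* (1994), §1.1 (Ex. 1.1.1, 1.2.3: kernels,
cokernels and quotients of chain complexes are computed degreewise) and Thm. 1.3.1: an injective
cochain map `f : A ↪ B` gives the short exact sequence of complexes `0 → A → B → B/A → 0`, where
`(B/A)ⁿ = Bⁿ / f(Aⁿ)` carries the induced differential, and hence (file
`NatCochainLongExactSequence`) the long exact cohomology sequence.

In the tree's concrete format (`NatCochain`, modules over a commutative ring, `ℕ`-indexed):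

* `NatCochain.Coker f n = Bⁿ ⧸ range fⁿ` with the induced differential `NatCochain.cokerD`, and
  `NatCochain.cokerSeq` — the `ShortExactSeq dA dB (cokerD …)` of an injective cochain map into a
  complex (so `ShortExactSeq.delta`, `exact_map_map`, `exact_map_delta`, `exact_delta_map` apply);
* functoriality: a commutative square of cochain maps `v ∘ f = f' ∘ u` induces the cochain map
  `NatCochain.Coker.map` on cokernel complexes (`Coker.map_comm`), which is injective in degree `n`
  as soon as `vⁿ b ∈ range f'ⁿ → b ∈ range fⁿ` (`Coker.injective_map`) and surjective when `vⁿ` is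
  (`Coker.surjective_map`).

Design note. For a short exact sequence of PRESHEAVES `0 → 𝓕' →ᵗ 𝓕 → 𝓠 → 0` on the nerve of a
cover (e.g. multiplication by a section `t` of a line bundle, `𝓠` the presheaf cokernel), the Čech
complex of `𝓠` is canonically the cokernel complex of `t : C•(𝔘, 𝓕') → C•(𝔘, 𝓕)` (a product of
quotients is the quotient of the products), so `Ȟ•(𝔘, 𝓠)` may be DEFINED through `Coker` without
constructing `𝓠`; iterating (`Coker.map` for a second section `t'` acting on both `𝓕'` and `𝓕`)
gives the Čech cohomology of the iterated cokernels used in the dimension count of Serre's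
theorem A (`EulerInequalityGrowth`).

## References

* C. A. Weibel, *An Introduction to Homological Algebra*, CUP (1994), Ex. 1.1.1, 1.2.3,
  Thm. 1.3.1. [Weibel1994]
-/

namespace Literature.Algebra.Homology

universe u w w' v v'

open Function

variable {R : Type u} [CommRing R]

namespace NatCochain

variable {A : ℕ → Type w} [∀ n, AddCommGroup (A n)] [∀ n, Module R (A n)]
  {B : ℕ → Type w'} [∀ n, AddCommGroup (B n)] [∀ n, Module R (B n)]

/-- **The cokernel complex, degreewise**: `(B/A)ⁿ = Bⁿ ⧸ range fⁿ` for a family of linear maps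
`fⁿ : Aⁿ → Bⁿ`. [cite: Weibel1994, Ex. 1.1.1 and 1.2.3] -/
abbrev Coker (f : ∀ n, A n →ₗ[R] B n) (n : ℕ) : Type w' :=
  B n ⧸ LinearMap.range (f n)

variable {dA : ∀ n, A n →ₗ[R] A (n + 1)} {dB : ∀ n, B n →ₗ[R] B (n + 1)}

/-- A cochain map sends `range fⁿ` into the preimage of `range fⁿ⁺¹` under `dB`. [folklore] -/
theorem range_le_comap_range (f : ∀ n, A n →ₗ[R] B n)
    (hf : ∀ n x, f (n + 1) (dA n x) = dB n (f n x)) (n : ℕ) :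
    LinearMap.range (f n) ≤ (LinearMap.range (f (n + 1))).comap (dB n) := by
  rintro _ ⟨a, rfl⟩
  exact ⟨dA n a, hf n a⟩

/-- **The induced differential on the cokernel complex**, `[b] ↦ [dB b]`.
[cite: Weibel1994, Ex. 1.1.1 and 1.2.3] -/
def cokerD (f : ∀ n, A n →ₗ[R] B n) (hf : ∀ n x, f (n + 1) (dA n x) = dB n (f n x)) (n : ℕ) :
    Coker f n →ₗ[R] Coker f (n + 1) :=
  Submodule.mapQ _ _ (dB n) (range_le_comap_range f hf n)

/-- The induced differential on classes. [folklore] -/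
@[simp]
theorem cokerD_mk (f : ∀ n, A n →ₗ[R] B n) (hf : ∀ n x, f (n + 1) (dA n x) = dB n (f n x))
    (n : ℕ) (b : B n) :
    cokerD f hf n (Submodule.Quotient.mk b) = Submodule.Quotient.mk (dB n b) :=
  rfl

/-- The cokernel complex is a complex if `B` is. [folklore] -/
theorem cokerD_cokerD (f : ∀ n, A n →ₗ[R] B n) (hf : ∀ n x, f (n + 1) (dA n x) = dB n (f n x))
    (hB : ∀ n x, dB (n + 1) (dB n x) = 0) (n : ℕ) (c : Coker f n) :
    cokerD f hf (n + 1) (cokerD f hf n c) = 0 := by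
  obtain ⟨b, rfl⟩ := Submodule.Quotient.mk_surjective _ c
  rw [cokerD_mk, cokerD_mk, hB, Submodule.Quotient.mk_zero]

/-- **The short exact sequence `0 → A → B → B/A → 0` of an injective cochain map into a
complex** (`g` the quotient maps). [cite: Weibel1994, Thm. 1.3.1] -/
def cokerSeq (f : ∀ n, A n →ₗ[R] B n) (hf : ∀ n x, f (n + 1) (dA n x) = dB n (f n x))
    (hinj : ∀ n, Injective (f n)) (hB : ∀ n x, dB (n + 1) (dB n x) = 0) :
    ShortExactSeq dA dB (cokerD f hf) where
  f := f
  g n := (LinearMap.range (f n)).mkQ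
  comm_f := hf
  comm_g _ _ := rfl
  injective_f := hinj
  exact_fg n := LinearMap.exact_map_mkQ_range (f n)
  surjective_g _ := Submodule.mkQ_surjective _
  dB_dB := hB

/-- The first map of `cokerSeq` is `f`. [folklore] -/
@[simp]
theorem cokerSeq_f (f : ∀ n, A n →ₗ[R] B n) (hf : ∀ n x, f (n + 1) (dA n x) = dB n (f n x))
    (hinj : ∀ n, Injective (f n)) (hB : ∀ n x, dB (n + 1) (dB n x) = 0) :
    (cokerSeq f hf hinj hB).f = f :=
  rfl

/-- The second map of `cokerSeq` is the quotient map. [folklore] -/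
@[simp]
theorem cokerSeq_g_apply (f : ∀ n, A n →ₗ[R] B n) (hf : ∀ n x, f (n + 1) (dA n x) = dB n (f n x))
    (hinj : ∀ n, Injective (f n)) (hB : ∀ n x, dB (n + 1) (dB n x) = 0) (n : ℕ) (b : B n) :
    (cokerSeq f hf hinj hB).g n b = Submodule.Quotient.mk b :=
  rfl

/-! ### Functoriality of the cokernel complex -/

namespace Coker

variable {A' : ℕ → Type v} [∀ n, AddCommGroup (A' n)] [∀ n, Module R (A' n)]
  {B' : ℕ → Type v'} [∀ n, AddCommGroup (B' n)] [∀ n, Module R (B' n)]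
  {f : ∀ n, A n →ₗ[R] B n} {f' : ∀ n, A' n →ₗ[R] B' n}

/-- A commutative square `v ∘ f = f' ∘ u` sends `range fⁿ` into the preimage of `range f'ⁿ`.
[folklore] -/
theorem range_le_comap_range_of_comm (u : ∀ n, A n →ₗ[R] A' n) (v : ∀ n, B n →ₗ[R] B' n)
    (huv : ∀ n x, v n (f n x) = f' n (u n x)) (n : ℕ) :
    LinearMap.range (f n) ≤ (LinearMap.range (f' n)).comap (v n) := by
  rintro _ ⟨a, rfl⟩
  exact ⟨u n a, (huv n a).symm⟩

/-- **The map induced on cokernels by a commutative square** `v ∘ f = f' ∘ u`, degreewise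
`[b] ↦ [v b]`. [cite: Weibel1994, Ex. 1.1.1] -/
def map (u : ∀ n, A n →ₗ[R] A' n) (v : ∀ n, B n →ₗ[R] B' n)
    (huv : ∀ n x, v n (f n x) = f' n (u n x)) (n : ℕ) : Coker f n →ₗ[R] Coker f' n :=
  Submodule.mapQ _ _ (v n) (range_le_comap_range_of_comm u v huv n)

/-- The induced map on classes. [folklore] -/
@[simp]
theorem map_mk (u : ∀ n, A n →ₗ[R] A' n) (v : ∀ n, B n →ₗ[R] B' n)
    (huv : ∀ n x, v n (f n x) = f' n (u n x)) (n : ℕ) (b : B n) :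
    map u v huv n (Submodule.Quotient.mk b) = Submodule.Quotient.mk (v n b) :=
  rfl

variable {dA' : ∀ n, A' n →ₗ[R] A' (n + 1)} {dB' : ∀ n, B' n →ₗ[R] B' (n + 1)}

/-- **The induced map is a cochain map** between the cokernel complexes when `v` is a cochain
map (in the convention of `NatCochain.Cohomology.map`). [cite: Weibel1994, Ex. 1.1.1] -/
theorem map_comm (hf : ∀ n x, f (n + 1) (dA n x) = dB n (f n x))
    (hf' : ∀ n x, f' (n + 1) (dA' n x) = dB' n (f' n x))
    (u : ∀ n, A n →ₗ[R] A' n) (v : ∀ n, B n →ₗ[R] B' n)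
    (huv : ∀ n x, v n (f n x) = f' n (u n x)) (hv : ∀ n x, v (n + 1) (dB n x) = dB' n (v n x))
    (n : ℕ) (c : Coker f n) :
    map u v huv (n + 1) (cokerD f hf n c) = cokerD f' hf' n (map u v huv n c) := by
  obtain ⟨b, rfl⟩ := Submodule.Quotient.mk_surjective _ c
  rw [cokerD_mk, map_mk, map_mk, cokerD_mk, hv]

/-- **Injectivity of the induced map on cokernels**: if `vⁿ b ∈ range f'ⁿ` forces
`b ∈ range fⁿ` (for the square "multiply by a second section `t'`" this is the statement that
`t'` is a non-zero-divisor modulo `t`), then `Coker.map` is injective in degree `n`. [folklore] -/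
theorem injective_map (u : ∀ n, A n →ₗ[R] A' n) (v : ∀ n, B n →ₗ[R] B' n)
    (huv : ∀ n x, v n (f n x) = f' n (u n x)) (n : ℕ)
    (h : ∀ b : B n, v n b ∈ LinearMap.range (f' n) → b ∈ LinearMap.range (f n)) :
    Injective (map u v huv n) := by
  rw [← LinearMap.ker_eq_bot, Submodule.eq_bot_iff]
  intro c hc
  obtain ⟨b, rfl⟩ := Submodule.Quotient.mk_surjective _ c
  rw [LinearMap.mem_ker, map_mk, Submodule.Quotient.mk_eq_zero] at hc
  exact (Submodule.Quotient.mk_eq_zero _).2 (h b hc)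

/-- **Surjectivity of the induced map on cokernels** from the surjectivity of `vⁿ`. [folklore] -/
theorem surjective_map (u : ∀ n, A n →ₗ[R] A' n) (v : ∀ n, B n →ₗ[R] B' n)
    (huv : ∀ n x, v n (f n x) = f' n (u n x)) (n : ℕ) (hv : Surjective (v n)) :
    Surjective (map u v huv n) := by
  intro c'
  obtain ⟨b', rfl⟩ := Submodule.Quotient.mk_surjective _ c'
  obtain ⟨b, rfl⟩ := hv b'
  exact ⟨Submodule.Quotient.mk b, rfl⟩

/-- **The range of the induced map on cokernels**: `[b'] ∈ range (Coker.map)` iff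
`b' ∈ range vⁿ + range f'ⁿ`. [folklore] -/
theorem mk_mem_range_map_iff (u : ∀ n, A n →ₗ[R] A' n) (v : ∀ n, B n →ₗ[R] B' n)
    (huv : ∀ n x, v n (f n x) = f' n (u n x)) (n : ℕ) (b' : B' n) :
    Submodule.Quotient.mk b' ∈ LinearMap.range (map u v huv n) ↔
      b' ∈ LinearMap.range (v n) ⊔ LinearMap.range (f' n) := by
  constructor
  · rintro ⟨c, hc⟩
    obtain ⟨b, rfl⟩ := Submodule.Quotient.mk_surjective _ c
    rw [map_mk, Submodule.Quotient.eq] at hc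
    have : b' = v n b - (v n b - b') := by abel
    rw [this]
    exact Submodule.sub_mem _ (Submodule.mem_sup_left ⟨b, rfl⟩) (Submodule.mem_sup_right hc)
  · intro hb'
    obtain ⟨y, ⟨b, rfl⟩, z, hz, rfl⟩ := Submodule.mem_sup.1 hb'
    refine ⟨Submodule.Quotient.mk b, ?_⟩
    rw [map_mk, Submodule.Quotient.eq, sub_add_cancel_left]
    exact neg_mem hz

end Coker

end NatCochain

end Literature.Algebra.Homology
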